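import Literature.AnabelianGeometry.EtaleTheta.Discharge.Sec4NonVacuityTowerPicture
import Literature.AnabelianGeometry.EtaleTheta.Discharge.Sec4Remark411
import HarnessLib

/-!
# [EtTh] Remark 4.1.1 HOLDS over the GENUINE Kummer tower — the categorical quotient by `G · μ_N(A)`
# (consistency witness, part 14; proof-only)

S. Mochizuki, *The étale theta function and its Frobenioid-theoretic manifestations*, Publ. RIMS **45**
(2009) [MochizukiEtTh2009], §4, Def 4.1 (iv) p.87 (morphisms of base-Frobenius type: (b) "`G` maps isomorphically
to `Gal(A^bs/B^bs)`"), Remark 4.1.1 p.88 ("`A → B` is a categorical quotient of `A` by `G · μ_N(A)` in the full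
subcategory of Frobenius-trivial objects"); [FrdI] Thm 5.2 (i)(ii) (the model Frobenioid).

CONSISTENCY WITNESS, TOY — PROOF-ONLY (no definition, no named fact, no instance, no `sorry`); sequel of the
`ToyTower` programme (`Sec4NonVacuityTower*.lean`, p438749 p439046 p439630 p440797: the genuine Kummer tower of
`𝔾_m/ℂ` with deck transformations `Aut(X_N) = ℤ/N`, `B = ℂˣ × t^ℤ` with the twisted pull-back, `Π^tp_X ↠ ℤ ↠ ℤ/N`).

* `ToyTower.remark411 p : (ToyTower.biKummerSetting p).Remark411` — **the typed [EtTh] Remark 4.1.1 HOLDS over the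
  genuine tower, BOTH clauses, for EVERY morphism `α : A → B` of base-Frobenius type and EVERY witnessing datum `d`**:
  the action clause by abc-iut-w4-d044's `remark411_actsOver`; the categorical-quotient clause
  (`remark411_quotient`) by an honest descent argument in the coordinates of the model Frobenioid:
  - Def 4.1 (iv)(b) forces `G` to contain a lift `γ` of the deck transformation `K ∈ ℤ/M` generating
    `Gal(X_M/X_K)`; its unit is a CONSTANT `c_γ` (`unit_aut_eq_cnst`);
  - invariance of `α` and of `ψ : A → X` under `γ` read `ζ_M^{K n_α} c_γ^N = 1`, `ζ_M^{K n} c_γ^{deg ψ} = 1`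
    (`twist_mul_pow_eq_one_of_comp_eq`); invariance under `μ_N(A) ∋` "multiplication by `e^{2πi/N}`" reads
    `N ∣ deg ψ` (`dvd_degFr_of_comp_eq`); hence `M/K ∣ n − (deg ψ / N)·n_α` (`deg_dvd_of_twist_eq_one`) — the
    exponent of `u_ψ / u_α^{deg ψ/N}` descends to `X_K` (`exists_descend_unit`, the constant absorbing the twist);
  - the zero divisor descends because `Φ = ℚ_{≥0}` is perfect (`exists_descend_div`), the base arrow because
    `Base(ψ)` kills `Gal(X_M/X_K)`; relation (d) of [FrdI] Thm 5.2 (i) for the descended morphism by injectivity of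
    `Φ^gp`-transport (`pullGp_injective`); uniqueness componentwise (covers are epi, pull-backs injective).
* READING (neutral).  At the COLLAPSED toy the typed Rmk 4.1.1 FAILS (`ToyCov.not_remark411`: `Aut_D(∗) = 1` cannot
  see the degree-`2` cover, so (iv)(b) allows `G = 1` and the Frobenius endomorphism is a counterexample — the
  instance behind abc-iut-f-108's schema refutation F-0729), and at the cover-free toy it holds only degenerately
  (`Toy.remark411`: every base-Frobenius-type `α` is an isomorphism).  Over the genuine tower (iv)(b) has content
  (`G ⥲ ℤ/(M/K)`, possibly with a TWISTED lift of the deck transformations) and the typed statement HOLDS with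
  genuine degree-`N` data: the refutations of record are artefacts of the collapsed base, not of the typed text.

HONEST LIMITS: a toy (𝔾_m, not a Tate curve; trivial [FrdI] vocabularies; `(N,H)`-slot `True`); consistency ≠
faithfulness; typed ≠ proved.  Nothing here bears on, or takes a side on, [IUTchIII] Cor. 3.12.
-/

noncomputable section

namespace Literature.AnabelianGeometry.EtaleTheta

open CategoryTheory Opposite Literature.AlgebraicGeometry.Frobenioids
open scoped NNRat

namespace ToyTower

open Base

variable (p : ℕ) [Fact p.Prime]

/-! ## Transport along the tower, in coordinates -/

/-- `Φ^gp`-transport along `f : X_M → X_N` is the `(M/N)`-th power. [cite: MochizukiEtTh2009, Def 3.3 p.73] -/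
theorem pullGp_tower {A B : ToyTower.Base} (f : B ⟶ A)
    (x : Algebra.GrothendieckGroup (ToyTower.temperedFrobenioid.divisorMonoid.obj (op A))) :
    pullGp ToyTower.temperedFrobenioid.divisorMonoid f x = x ^ deg f := by
  change gpMap (ToyTower.temperedFrobenioid.Φ.pull f.op) x = x ^ deg f
  exact gpMap_pull f x

/-- An endomorphism of `X_M` has degree `1`. [cite: MochizukiEtTh2009, Def 3.6 p.76] -/
theorem deg_endo {A : ToyTower.Base} (f : A ⟶ A) : deg f = 1 := Nat.div_self A.lvl.pos

/-- `Φ^gp`-transport along an endomorphism of `X_M` is the identity. [cite: MochizukiEtTh2009, Def 3.3 p.73] -/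
theorem pullGp_endo {A : ToyTower.Base} (f : A ⟶ A)
    (x : Algebra.GrothendieckGroup (ToyTower.temperedFrobenioid.divisorMonoid.obj (op A))) :
    pullGp ToyTower.temperedFrobenioid.divisorMonoid f x = x := by
  rw [pullGp_tower, deg_endo, pow_one]

/-- `Φ`-transport in coordinates: `a ↦ a^{deg f}`. [cite: MochizukiEtTh2009, Def 3.3 p.73] -/
theorem coe_divisorMonoid_map {A B : ToyTower.Base} (f : B ⟶ A)
    (a : ToyTower.temperedFrobenioid.divisorMonoid.obj (op A)) :
    ((ToyTower.temperedFrobenioid.divisorMonoid.map f.op).hom a).1 = a.1 ^ deg f := rfl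

/-- `B`-transport in coordinates: `pullFn` on the monomial part. [cite: MochizukiEtTh2009, Def 3.3 p.73] -/
theorem coe_ratFnFunctor_map {A B : ToyTower.Base} (f : B ⟶ A)
    (u : ToyTower.temperedFrobenioid.ratFnFunctor.obj (op A)) :
    ((ToyTower.temperedFrobenioid.ratFnFunctor.map f.op).hom u).1.1 = ToyTower.pullFn f u.1.1 := rfl

/-- The comparison `Φ^gp → (Φ^{ℝ-log})^gp` of the fibre product is injective (here `Φ = ⊤ ⊆ ℚ_{≥0}`).
[cite: MochizukiEtTh2009, Def 3.6 p.77] -/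
theorem ΦgpToRlog_injective (A : ToyTower.Baseᵒᵖ) :
    Function.Injective (ToyTower.temperedFrobenioid.ΦgpToRlog A) := by
  let g : Algebra.GrothendieckGroup (Multiplicative ℚ≥0) →*
      Algebra.GrothendieckGroup (⊤ : Submonoid (Multiplicative ℚ≥0)) :=
    gpMap ((Submonoid.topEquiv (M := Multiplicative ℚ≥0)).symm : Multiplicative ℚ≥0 →* _)
  have h : ∀ x, g (ToyTower.temperedFrobenioid.ΦgpToRlog A x) = x := fun x =>
    DFunLike.congr_fun (MonGp.hom_ext (g₁ := g.comp (ToyTower.temperedFrobenioid.ΦgpToRlog A))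
      (g₂ := MonoidHom.id _) fun a => by
        change g (gpMap (Submonoid.subtype ⊤) (Algebra.GrothendieckGroup.of a)) = Algebra.GrothendieckGroup.of a
        rw [gpMap_of]
        change gpMap _ _ = _
        rw [gpMap_of]
        rfl) x
  intro x y hxy
  rw [← h x, ← h y, hxy]

/-- The monomial exponent determines the `Φ^gp`-component of an element of `B(X_N)` (fibre product).
[cite: MochizukiEtTh2009, Def 3.6 p.77] -/
theorem ratFn_snd_eq_of_fst_snd_eq {A : ToyTower.Base} (u v : ToyTower.temperedFrobenioid.ratFnFunctor.obj (op A))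
    (h : u.1.1.2 = v.1.1.2) : u.1.2 = v.1.2 := by
  apply ΦgpToRlog_injective (op A)
  have hu := u.2
  have hv := v.2
  change Toy.divHomQ u.1.1.2 = _ at hu
  change Toy.divHomQ v.1.1.2 = _ at hv
  rw [← hu, ← hv, h]

/-- An element of `B(X_N)` is determined by its monomial part `(c, n)`. [cite: MochizukiEtTh2009, Def 3.6 p.77] -/
theorem ratFn_ext {A : ToyTower.Base} {u v : ToyTower.temperedFrobenioid.ratFnFunctor.obj (op A)}
    (h : u.1.1 = v.1.1) : u = v :=
  Subtype.ext (Prod.ext h (ratFn_snd_eq_of_fst_snd_eq u v (congrArg Prod.snd h)))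

/-! ## Automorphisms of the tower Frobenioid in coordinates -/

/-- The unit of an automorphism of `A` is a constant (its divisor is `0`: `Div(σ) = 0` and the base part, an
endomorphism of `X_M`, acts trivially on `Φ^gp`). [cite: MochizukiFrdI2008, Thm. 5.2(ii) p.101] -/
theorem unit_aut_eq_cnst {A : ToyTower.temperedFrobenioid.category} (σ : Aut A) :
    ModelFrobenioid.unit σ.hom = ToyTower.cnst A (ModelFrobenioid.unit σ.hom).1.1.1 := by
  apply eq_cnst_of_divB_eq_one
  have hrel := ModelFrobenioid.rel σ.hom
  rw [(ModelFrobenioid.degFr_hom_eq_one σ).1, PNat.one_coe, pow_one,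
    ModelFrobenioid.div_eq_one_of_isIso ToyTower.divisorMonoid_isDivisorial σ.hom, map_one, mul_one,
    pullGp_endo] at hrel
  exact (mul_eq_left.mp hrel.symm)

/-- **Invariance in coordinates**: if `σ ≫ ψ = ψ` for an automorphism `σ` of `A` with base part the deck
transformation `a` and unit the constant `c_σ`, and `u_ψ = c·t^n`, then `ζ^{a n} · c_σ^{deg_Fr ψ} = 1` and
`a ≫ Base(ψ) = Base(ψ)`. [cite: MochizukiEtTh2009, Rmk 4.1.1 p.88] -/
theorem twist_mul_pow_eq_one_of_comp_eq {A X : ToyTower.temperedFrobenioid.category} (σ : Aut A) (ψ : A ⟶ X)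
    (h : σ.hom ≫ ψ = ψ) :
    ToyTower.twist (ModelFrobenioid.baseMap σ.hom) (ModelFrobenioid.unit ψ).1.1.2 *
        (ModelFrobenioid.unit σ.hom).1.1.1 ^ (ModelFrobenioid.degFr ψ : ℕ) = 1 ∧
      ModelFrobenioid.baseMap σ.hom ≫ ModelFrobenioid.baseMap ψ = ModelFrobenioid.baseMap ψ := by
  refine ⟨?_, by rw [← ModelFrobenioid.baseMap_comp, h]⟩
  have hu := congrArg
    (fun φ : A ⟶ X => (ModelFrobenioid.unit φ : ToyTower.temperedFrobenioid.ratFnFunctor.obj (op A.base)).1.1.1) h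
  simp only [ModelFrobenioid.unit_comp] at hu
  rw [unit_aut_eq_cnst σ] at hu
  change ((ToyTower.pullFn (ModelFrobenioid.baseMap σ.hom) (ModelFrobenioid.unit ψ).1.1).1 *
      ((((ModelFrobenioid.unit σ.hom).1.1.1, (1 : Multiplicative ℤ)) : ToyTower.Fn) ^
        (ModelFrobenioid.degFr ψ : ℕ)).1 : ℂˣ) = (ModelFrobenioid.unit ψ).1.1.1 at hu
  rw [pullFn_apply, Prod.pow_mk, mul_assoc] at hu
  exact mul_eq_left.mp hu

/-- The `N`-th roots of unity act: for `ζ ∈ ℂˣ` with `ζ^N = 1`, "multiplication by `ζ`" lies in `μ_N(A)`.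
[cite: MochizukiEtTh2009, Def 4.1 p.87] -/
theorem coefAut_mem_mu (A : ToyTower.temperedFrobenioid.category) (N : ℕ+) {ζ : ℂˣ} (hζ : ζ ^ (N : ℕ) = 1) :
    ToyTower.coefAut A ζ ∈ ToyTower.temperedFrobenioid.mu A N := by
  refine ⟨ToyTower.coefAut_mem_units A ζ, ?_⟩
  have hinj : Function.Injective (ModelFrobenioid.unitsToRatFn A) :=
    ModelFrobenioid.unitsToRatFn_injective (ToyTower.divisorMonoid_isDivisorial A.base).isPreDivisorial.isIntegral
  have h : (ToyTower.coefUnit A ζ) ^ (N : ℕ) = 1 :=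
    hinj (by rw [map_pow, unitsToRatFn_coefUnit, ← map_pow, hζ, map_one, map_one])
  have h' := congrArg Subtype.val h
  rwa [SubmonoidClass.coe_pow] at h'

/-- **`μ_N`-invariance in coordinates**: if `ψ` is invariant under "multiplication by a primitive `N`-th root
of unity", then `N ∣ deg_Fr(ψ)`. [cite: MochizukiEtTh2009, Rmk 4.1.1 p.88] -/
theorem dvd_degFr_of_comp_eq {A X : ToyTower.temperedFrobenioid.category} (N : ℕ+) (ψ : A ⟶ X) {ζ : ℂˣ}
    (hζ : IsPrimitiveRoot ζ N) (h : (ToyTower.coefAut A ζ).hom ≫ ψ = ψ) :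
    (N : ℕ) ∣ (ModelFrobenioid.degFr ψ : ℕ) := by
  have h1 := (twist_mul_pow_eq_one_of_comp_eq (ToyTower.coefAut A ζ) ψ h).1
  change ToyTower.twist (𝟙 A.base) _ * ζ ^ (ModelFrobenioid.degFr ψ : ℕ) = 1 at h1
  rw [twist_eq_one _ (id_shift _), one_mul] at h1
  exact hζ.dvd_of_pow_eq_one _ h1

/-! ## Remark 4.1.1 over the tower: the three descent lemmas -/

/-- Transport of `Φ^gp` along a base arrow of the tower is injective (`k`-th powers in `(ℚ_{≥0})^gp`).
[cite: MochizukiEtTh2009, Def 3.3 p.73] -/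
theorem pullGp_injective {A B : ToyTower.Base} (f : B ⟶ A) :
    Function.Injective (pullGp ToyTower.temperedFrobenioid.divisorMonoid f) := by
  haveI : IsCancelMul (ToyTower.temperedFrobenioid.Φ.carrier (op A)) :=
    isIntegral_iff_isCancelMul.mp (ToyTower.divisorMonoid_isDivisorial A).isPreDivisorial.isIntegral
  intro x y hxy
  rw [pullGp_tower, pullGp_tower] at hxy
  exact ((isPerfect_grothendieckGroup (P := ToyTower.temperedFrobenioid.Φ.carrier (op A))
    (ToyTower.temperedFrobenioid_isPerfect (op A))).bijective_pow _ (deg_pos f)).1 hxy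

/-- **Arithmetic core of the descent**: if the deck transformation `K ∈ ℤ/M` (generator of `Gal(X_M/X_K)`),
twisted by a constant `c`, fixes both `c_α t^{n_α}` in degree `N` and `c t^n` in degree `N d'`, then
`M/K ∣ n − d' n_α`. [cite: MochizukiEtTh2009, Rmk 4.1.1 p.88] -/
theorem deg_dvd_of_twist_eq_one {M K : ToyTower.Base} (b₁ : M ⟶ K) (n nα : Multiplicative ℤ) (c : ℂˣ)
    (N d' : ℕ)
    (hα : ToyTower.twist (shiftIso M (((K.lvl : ℕ) : ZMod M.lvl))).hom nα * c ^ N = 1)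
    (hψ : ToyTower.twist (shiftIso M (((K.lvl : ℕ) : ZMod M.lvl))).hom n * c ^ (N * d') = 1) :
    (deg b₁ : ℤ) ∣ Multiplicative.toAdd n - d' * Multiplicative.toAdd nα := by
  haveI : NeZero ((M.lvl : ℕ)) := ⟨M.lvl.ne_zero⟩
  set m : ℤ := Multiplicative.toAdd n - d' * Multiplicative.toAdd nα with hm
  have hT : ToyTower.twist (shiftIso M (((K.lvl : ℕ) : ZMod M.lvl))).hom (n * (nα ^ d')⁻¹) = 1 := by
    have h1 : ToyTower.twist (shiftIso M (((K.lvl : ℕ) : ZMod M.lvl))).hom (nα ^ d') * c ^ (N * d') = 1 := by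
      rw [map_pow, pow_mul, ← mul_pow, hα, one_pow]
    rw [map_mul, map_inv, mul_right_cancel (hψ.trans h1.symm), mul_inv_cancel]
  have hmeq : Multiplicative.toAdd (n * (nα ^ d')⁻¹) = m := by
    rw [toAdd_mul, toAdd_inv, toAdd_pow, nsmul_eq_mul, hm]
    ring
  rw [twist_apply, hmeq] at hT
  have hT' := congrArg (fun z : ℂˣ => (z : ℂ)) hT
  rw [Circle.toUnits_apply, Units.val_mk0, Units.val_one, Circle.coe_eq_one] at hT'
  have hx := ZMod.injective_toCircle (hT'.trans (ZMod.toCircle (N := (M.lvl : ℕ))).map_zero_eq_one.symm)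
  change ((m : ℤ) : ZMod M.lvl) * (((K.lvl : ℕ) : ZMod M.lvl)) = 0 at hx
  rw [← Int.cast_natCast, ← Int.cast_mul] at hx
  have hmK : ((M.lvl : ℕ) : ℤ) ∣ m * (K.lvl : ℕ) := (ZMod.intCast_zmod_eq_zero_iff_dvd _ _).mp hx
  have hM : ((M.lvl : ℕ) : ℤ) = (deg b₁ : ℤ) * ((K.lvl : ℕ) : ℤ) := by
    rw [← deg_mul_lvl b₁]; push_cast; ring
  rw [hM] at hmK
  exact Int.dvd_of_mul_dvd_mul_right (by exact_mod_cast K.lvl.ne_zero) hmK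

/-- **Descent of the zero divisor** along `X_M → X_K` (`Φ = ℚ_{≥0}` is perfect). [cite: MochizukiEtTh2009, Rmk 4.1.1 p.88] -/
theorem exists_descend_div {M K : ToyTower.Base} (b₁ : M ⟶ K) (D : ToyTower.temperedFrobenioid.divisorMonoid.obj (op M)) :
    ∃ D' : ToyTower.temperedFrobenioid.divisorMonoid.obj (op K),
      (ToyTower.temperedFrobenioid.divisorMonoid.map b₁.op).hom D' = D := by
  obtain ⟨D', hD'⟩ : ∃ a : ToyTower.temperedFrobenioid.divisorMonoid.obj (op K), a ^ deg b₁ = D :=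
    ((ToyTower.temperedFrobenioid_isPerfect (op K)).bijective_pow _ (deg_pos b₁)).2 D
  exact ⟨D', Subtype.ext ((coe_divisorMonoid_map b₁ D').trans (congrArg Subtype.val hD'))⟩

/-- **Descent of the unit** along `b₁ : X_M → X_K`: if the exponent of `u / u_α^{d'}` is `(M/K) · n'`, then
`u = B(b₁)(u') · u_α^{d'}` for the monomial `u' = c' t_K^{n'}` with the constant `c'` absorbing the twist.
[cite: MochizukiEtTh2009, Rmk 4.1.1 p.88] -/
theorem exists_descend_unit {M K : ToyTower.Base} (b₁ : M ⟶ K)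
    (u uα : ToyTower.temperedFrobenioid.ratFnFunctor.obj (op M)) (d' : ℕ) (n' : ℤ)
    (h : Multiplicative.toAdd u.1.1.2 - d' * Multiplicative.toAdd uα.1.1.2 = deg b₁ * n') :
    ∃ u' : ToyTower.temperedFrobenioid.ratFnFunctor.obj (op K),
      (ToyTower.temperedFrobenioid.ratFnFunctor.map b₁.op).hom u' * uα ^ d' = u := by
  let ξ' : Algebra.GrothendieckGroup (ToyTower.temperedFrobenioid.Φ.carrier (op K)) :=
    Algebra.GrothendieckGroup.of (⟨Multiplicative.ofAdd (1 : ℚ≥0), trivial⟩ :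
      ToyTower.temperedFrobenioid.Φ.carrier (op K)) ^ n'
  set c' : ℂˣ := u.1.1.1 * (uα.1.1.1 ^ d')⁻¹ * (ToyTower.twist b₁ (Multiplicative.ofAdd n'))⁻¹ with hc'
  refine ⟨⟨(((c', Multiplicative.ofAdd n') : ToyTower.Fn), ξ'), ?_⟩, ?_⟩
  · change Toy.divHomQ (Multiplicative.ofAdd n') = gpMap _ (Algebra.GrothendieckGroup.of _ ^ n')
    rw [map_zpow, gpMap_of, Toy.divHomQ, zpowersHom_apply, toAdd_ofAdd]
    rfl
  apply ratFn_ext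
  refine Prod.ext ?_ ?_
  · change c' * ToyTower.twist b₁ (Multiplicative.ofAdd n') * uα.1.1.1 ^ d' = u.1.1.1
    rw [hc']
    group
  · change Multiplicative.ofAdd n' ^ deg b₁ * uα.1.1.2 ^ d' = u.1.1.2
    apply Multiplicative.toAdd.injective
    rw [toAdd_mul, toAdd_pow, toAdd_pow, toAdd_ofAdd, nsmul_eq_mul, nsmul_eq_mul]
    linarith

/-! ## Remark 4.1.1 over the tower -/

/-- **The categorical-quotient clause of [EtTh] Remark 4.1.1 over the GENUINE Kummer tower**, in the model
coordinates (`A`, `B`, `X` objects of the tower Frobenioid): for `α : A → B` of base-Frobenius type with datum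
`d` and `ψ : A → X` invariant under `G · μ_N(A)`, there is a unique `ψ'` with `α ≫ ψ' = ψ`.  PROOF: Def 4.1 (iv)(b)
forces `G` to contain a lift `γ` of the deck transformation `K ∈ ℤ/M` generating `Gal(X_M/X_K)`, with constant unit
`c_γ`; invariance of `α` and of `ψ` under `γ` and of `ψ` under `μ_N(A)` (`N ∣ deg ψ`) give `M/K ∣ n − (deg ψ/N) n_α`
(`deg_dvd_of_twist_eq_one`), so the exponent descends to `X_K`; the zero divisor descends because `Φ` is perfect, the
constant absorbs the twist, and the base arrow descends because `Base(ψ)` kills `Gal(X_M/X_K)`.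
[cite: MochizukiEtTh2009, Rmk 4.1.1 p.88] -/
theorem remark411_quotient {A B : ToyTower.temperedFrobenioid.category} (α : A ⟶ B)
    (d : (ToyTower.biKummerSetting p).BaseFrobeniusTypeData α) ⦃X : ToyTower.temperedFrobenioid.category⦄ (ψ : A ⟶ X)
    (hψ : ∀ γ ∈ d.G ⊔ Subgroup.closure ((ToyTower.biKummerSetting p).mu A ((ToyTower.biKummerSetting p).degFr α)),
      γ.hom ≫ ψ = ψ) :
    ∃! ψ' : B ⟶ X, α ≫ ψ' = ψ := by
  -- the data in coordinates
  obtain ⟨h1n, h1d⟩ :=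
    ModelFrobenioid.degFr_div_of_isPullbackMorphism ToyTower.divisorMonoid_isDivisorial d.cond_d
  have h2d : ModelFrobenioid.div d.α₂ = 1 := d.cond_c.2.1.2
  have hfac : (d.α₂ ≫ d.α₁ : A ⟶ B) = α := d.fac
  have hdivα : ModelFrobenioid.div α = 1 := by
    rw [← hfac, ModelFrobenioid.div_comp, h1d, h2d, one_pow, mul_one]
    exact map_one _
  set N : ℕ+ := ModelFrobenioid.degFr α with hN
  set b₁ : A.base ⟶ B.base := ModelFrobenioid.baseMap α with hb₁
  set b : A.base ⟶ X.base := ModelFrobenioid.baseMap ψ with hb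
  set u : ToyTower.temperedFrobenioid.ratFnFunctor.obj (op A.base) := ModelFrobenioid.unit ψ with hu
  set uα : ToyTower.temperedFrobenioid.ratFnFunctor.obj (op A.base) := ModelFrobenioid.unit α with huα
  -- the deck transformation generating `Gal(X_M/X_K)` and its lift `γ ∈ G`
  have hσ₀ : shiftIso A.base (((B.base.lvl : ℕ) : ZMod A.base.lvl)) ∈ (ToyTower.biKummerSetting p).galOver α := by
    change (shiftIso A.base (((B.base.lvl : ℕ) : ZMod A.base.lvl))).hom ≫ b₁ = b₁
    apply Base.hom_ext
    rw [comp_shift]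
    change ZMod.castHom b₁.dvd _ (((B.base.lvl : ℕ) : ZMod A.base.lvl)) + b₁.shift = b₁.shift
    rw [map_natCast, ZMod.natCast_self, zero_add]
  obtain ⟨γ, hγG, hγσ⟩ := d.mapsIsomorphically.surjOn hσ₀
  have hbγ : ModelFrobenioid.baseMap γ.hom = (shiftIso A.base (((B.base.lvl : ℕ) : ZMod A.base.lvl))).hom :=
    congrArg Iso.hom hγσ
  have hγα : γ.hom ≫ α = α := d.G_le hγG
  have hγψ : γ.hom ≫ ψ = ψ := hψ γ (Subgroup.mem_sup_left hγG)
  -- `μ_N`-invariance: `N ∣ deg_Fr ψ`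
  have hN0 : ((N : ℕ)) ≠ 0 := PNat.ne_zero N
  have hζ := Complex.isPrimitiveRoot_exp N hN0
  have hζu : IsPrimitiveRoot (hζ.isUnit hN0).unit N := hζ.isUnit_unit hN0
  have hτψ : (ToyTower.coefAut A (hζ.isUnit hN0).unit).hom ≫ ψ = ψ :=
    hψ _ (Subgroup.mem_sup_right (Subgroup.subset_closure (coefAut_mem_mu A N hζu.pow_eq_one)))
  obtain ⟨d', hd'⟩ := dvd_degFr_of_comp_eq N ψ hζu hτψ
  have hd'pos : 0 < d' := Nat.pos_of_ne_zero fun h => by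
    rw [h, mul_zero] at hd'
    exact PNat.ne_zero _ hd'
  let d'p : ℕ+ := ⟨d', hd'pos⟩
  have hdeg : d'p * N = ModelFrobenioid.degFr ψ := PNat.eq (by rw [PNat.mul_coe, hd', mul_comm]; rfl)
  -- the invariance equations in coordinates; `M/K ∣ n − d' n_α`; `L ∣ K`
  have Eα := (twist_mul_pow_eq_one_of_comp_eq γ α hγα).1
  obtain ⟨Eψ, Ebase⟩ := twist_mul_pow_eq_one_of_comp_eq γ ψ hγψ
  rw [hbγ] at Eα Eψ Ebase
  rw [hd'] at Eψ
  obtain ⟨n', hn'⟩ := deg_dvd_of_twist_eq_one b₁ u.1.1.2 uα.1.1.2 _ N d' Eα Eψ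
  have hLK : (X.base.lvl : ℕ) ∣ (B.base.lvl : ℕ) := by
    have h := congrArg Base.Hom.shift Ebase
    rw [comp_shift] at h
    change ZMod.castHom b.dvd _ (((B.base.lvl : ℕ) : ZMod A.base.lvl)) + b.shift = b.shift at h
    rw [map_natCast, add_eq_right] at h
    exact (ZMod.natCast_eq_zero_iff _ _).mp h
  -- the descended components
  let b' : B.base ⟶ X.base := ⟨b.shift - ZMod.castHom hLK _ b₁.shift, hLK⟩
  have hb' : b₁ ≫ b' = b := Base.hom_ext (by
    rw [comp_shift]
    change ZMod.castHom hLK _ b₁.shift + (b.shift - ZMod.castHom hLK _ b₁.shift) = b.shift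
    rw [add_sub_cancel])
  obtain ⟨Div', hDiv'⟩ := exists_descend_div b₁ (ModelFrobenioid.div ψ)
  obtain ⟨u', hu'⟩ := exists_descend_unit b₁ u uα d' n' hn'
  -- relation (d) for the descended morphism, by injectivity of `Φ^gp`-transport along `b₁`
  have hrelα : A.cls ^ (N : ℕ) = pullGp ToyTower.temperedFrobenioid.divisorMonoid b₁ B.cls *
      divB ToyTower.temperedFrobenioid.divisorMonoid ToyTower.temperedFrobenioid.ratFnFunctor
        ToyTower.temperedFrobenioid.divBNatTrans (op A.base) uα := by
    have h := ModelFrobenioid.rel α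
    rwa [hdivα, map_one, mul_one] at h
  have rel' : B.cls ^ d' * Algebra.GrothendieckGroup.of Div' =
      pullGp ToyTower.temperedFrobenioid.divisorMonoid b' X.cls *
        divB ToyTower.temperedFrobenioid.divisorMonoid ToyTower.temperedFrobenioid.ratFnFunctor
          ToyTower.temperedFrobenioid.divBNatTrans (op B.base) u' := by
    apply pullGp_injective b₁
    simp only [map_mul, map_pow]
    rw [pullGp_of, hDiv', ← pullGp_comp, hb', pullGp_divB]
    have key : pullGp ToyTower.temperedFrobenioid.divisorMonoid b X.cls *
        divB ToyTower.temperedFrobenioid.divisorMonoid ToyTower.temperedFrobenioid.ratFnFunctor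
          ToyTower.temperedFrobenioid.divBNatTrans (op A.base)
          ((ToyTower.temperedFrobenioid.ratFnFunctor.map b₁.op).hom u') *
        divB ToyTower.temperedFrobenioid.divisorMonoid ToyTower.temperedFrobenioid.ratFnFunctor
          ToyTower.temperedFrobenioid.divBNatTrans (op A.base) uα ^ d' =
      pullGp ToyTower.temperedFrobenioid.divisorMonoid b₁ B.cls ^ d' *
        Algebra.GrothendieckGroup.of (ModelFrobenioid.div ψ) *
        divB ToyTower.temperedFrobenioid.divisorMonoid ToyTower.temperedFrobenioid.ratFnFunctor
          ToyTower.temperedFrobenioid.divBNatTrans (op A.base) uα ^ d' := by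
      rw [mul_assoc, ← map_pow, ← map_mul, hu', ← ModelFrobenioid.rel ψ, ← hdeg, PNat.mul_coe, pow_mul',
        hrelα, mul_pow, mul_right_comm]
      rfl
    exact (mul_right_cancel key).symm
  -- the descended morphism, the factorisation, uniqueness
  refine ⟨ModelFrobenioid.mkHom B X d'p b' Div' u' rel', ModelFrobenioid.hom_ext hdeg.symm.symm hb' ?_ hu',
    fun ψ'' h'' => ?_⟩
  · change (ToyTower.temperedFrobenioid.divisorMonoid.map b₁.op).hom Div' * ModelFrobenioid.div α ^ (d'p : ℕ) =
      ModelFrobenioid.div ψ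
    rw [hdivα, one_pow, mul_one, hDiv']
  have hdeg'' : ModelFrobenioid.degFr ψ'' = d'p := by
    have h := congrArg ModelFrobenioid.degFr h''
    rw [ModelFrobenioid.degFr_comp, ← hdeg] at h
    exact mul_right_cancel h
  have hbase'' : ModelFrobenioid.baseMap ψ'' = b' := by
    haveI := Base.epi b₁
    have h := congrArg ModelFrobenioid.baseMap h''
    rw [ModelFrobenioid.baseMap_comp, ← hb, ← hb'] at h
    exact (cancel_epi b₁).mp h
  have hdiv'' : ModelFrobenioid.div ψ'' = Div' := by
    have h := congrArg ModelFrobenioid.div h''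
    rw [ModelFrobenioid.div_comp, hdivα, one_pow, mul_one, ← hDiv'] at h
    exact ((ToyTower.temperedFrobenioid_isPerfect (op B.base)).bijective_pow _ (deg_pos b₁)).1
      (Subtype.ext (congrArg Subtype.val h))
  have hunit'' : ModelFrobenioid.unit ψ'' = u' := by
    have h := congrArg ModelFrobenioid.unit h''
    rw [ModelFrobenioid.unit_comp, hdeg'', ← hu, ← hu'] at h
    have hc := ((ToyTower.ratFnFunctor_isGroupLike A.base).isUnit (uα ^ (d'p : ℕ))).mul_left_inj.mp h
    exact (ToyTower.ratFnFunctor_isMonoidOn.isCharInjective b₁).1 hc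
  exact ModelFrobenioid.hom_ext hdeg'' hbase'' hdiv'' hunit''

/-- **[EtTh] Remark 4.1.1 HOLDS over the GENUINE Kummer tower** (typed `BiKummerSetting.Remark411`, both clauses,
for EVERY morphism of base-Frobenius type and EVERY witnessing datum): the action clause by abc-iut-w4-d044's
`remark411_actsOver`, the categorical-quotient clause by `remark411_quotient`.  Contrast `ToyCov.not_remark411`
(COLLAPSED base: `Aut(∗) = 1` cannot see the cover, so `G = 1` is allowed and the Frobenius endomorphism is a
counterexample) and `Toy.remark411` (degenerate: only degree-`1` data): over the genuine tower Def 4.1 (iv)(b)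
`G ⥲ Gal(A^bs/B^bs) = ℤ/(M/K)` has content, and the typed statement holds — with, if need be, a TWISTED lift of the
deck transformations in `G`. [cite: MochizukiEtTh2009, Rmk 4.1.1 p.88] -/
theorem remark411 : (ToyTower.biKummerSetting p).Remark411 := fun α d =>
  ⟨(ToyTower.biKummerSetting p).remark411_actsOver ToyTower.divisorMonoid_isDivisorial α d,
    fun _ _ ψ hψ => remark411_quotient p α d ψ hψ⟩

end ToyTower

end Literature.AnabelianGeometry.EtaleTheta

end
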